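import Literature.MathematicalPhysics.QuantumFieldTheory.Balaban1983to89.B9Thm33G0DirXHolderFromDds
import Literature.MathematicalPhysics.QuantumFieldTheory.Balaban1983to89.B9Thm313WholeDvHolderAtPinsGraded

/-!
# `Balaban1983to89.B9Thm33G0DirXHolderAtPinsGraded` — T. Bałaban, *Propagators for lattice gauge theories in a background field*, Commun. Math. Phys. **99** (1985)
# 389–434 [Balaban1985BackgroundPropagators] Thms 3.12–3.13 pp. 421–426 with Thm 3.3 (3.45) p. 398: THE W-c FACE `Thm33G0DirX.pXdDH` (Φ^X_β∘∇_{U,ν}∘G₀∘D_U) AT THE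
# GRADED TRANSPORTED PIN `bH13 := weightNorm (bHZG (taxiS U) p w) (Lʲη)⁻¹` — dag-n06-w6's engine `pXdDH_of_h45m_noLen` re-plugged with the transported J-letter
# (`hasMaj_JcoKH_graded`, NO small-gauge binder `hΘ`) and the (3.45) members read at the transported bond class `bHZKT (taxiB U) s p` along an exponent schedule `s(β) ∈ (β, 1)`

statement-level skeleton of published theorems with citation tags; proofs where landed; nothing here is a claim about the Yang–Mills mass gap

PDF held: `paper:balaban1985-cmp99-background-propagators` (journal page = PDF page + 388); pp. 397–398, 421–426 read by this seat (2026-08-28).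

THE PRINT (verbatim, p. 398, (3.45) and the remark after (3.47)): *«‖(G(U)λ)‖_{α,U} ≤ B′₀(ε,β)·‖λ‖_{β+ε} …»*, *«… the norms are taken with respect to the covariant
derivatives, i.e. with the parallel transport U(Γ_{xx′}) along the shortest contours Γ_{xx′} …»* — the input Hölder class of (3.45) has exponent STRICTLY above the output's,
and its pair differences are TRANSPORTED; p. 397, Thm 3.1: *«B₀(β) → ∞ if β → 1»*.

WHY THIS FILE (cell context, dag-n06-l g21; the knit's WORD-TZ = OPTION (2)).  dag-n06-w6's `B9Thm33G0DirXHolderAtPinsSmooth.pXdDH_smooth_of_h45` delivers the W-c face at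
the FLAT smooth pin `weightNorm (bHZ 1 p) (Lʲη)⁻¹` from (3.45) members at the flat bond class `bHZK 1 p` and this seat's flat letter `hasMaj_JcoKH_smooth` — whose small-gauge
binder `hΘ` is gauge-VARIANT and cannot be fed from the certificate's gauge-invariant classes (knit WORD-TZ), and whose single exponent 1 is not print-inhabitable for BOTH
the producers into the pin and its ∀β<1 consumers (this seat's LOCATED-U5).  OPTION (2), graded: the pin is `bH13 := weightNorm (bHZG (taxiS U) p w) (Lʲη)⁻¹`
(`B9SmoothHolderClassGraded`, TRANSPORTED pair differences along def-Y's taxicab transporters, GRADED over the exponents s ∈ (0,1) with weights w), the letter is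
`B9Thm313WholeDvHolderAtPinsGraded.hasMaj_JcoKH_graded` (binders: contracting links `hU` + the gauge-INVARIANT plaquette binder `hF`), and the (3.45) member for the output
exponent β is read at the transported bond class of exponent `s β ∈ (β, 1)` (print's `β + ε`).  dag-n06-w6's ENGINE `B9Thm33G0DirXHolderFromDds.pXdDH_of_h45m_noLen` is
used BY NAME and UNCHANGED; this file is the re-plug (the twin dag-n06-w6 was invited to write; filed by this seat to complete the graded member set for the pin edition).
PRIOR ART DECLARED.  Engine and face shape: dag-n06-w6 (`B9Thm33G0DirXHolderFromDds`, `…AtPinsSmooth`); kinematic decomposition `DvcoKH_eq_sum`: this seat (g12); graded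
classes, transported letter, `CJG ∕ thetaL`: this seat (g21).  Nothing of theirs is restated.

WHAT IS PROVED (sorry-free; 0 `def`; nothing of [B9] asserted).
* ★★ `pXdDH_graded_of_h45` — at the kinematic pins (`hDv`, `hDds`), under `hβ1 ∕ hbI0`, contracting links `hU`, the plaquette binder `hF` (`ϑF ≥ 0`), weights `0 ≤ w ≤ 1`,
  an exponent schedule `sch` with `β < · ` irrelevant to the engine but `0 < sch β < 1` and `0 < w (sch β)` on `β ∈ [0,1)`, the row-sum ∕ (2.61) facts, and ONE displayed
  (3.45) schema `h45` read at `bHZKT (taxiB U) (sch β) p`: for every `ν` and `β ∈ [0,1)`, `HasMaj (weightNorm (bHZG (taxiS U) p w) (Lʲη)⁻¹) (𝔠_P^{(β−1)})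
  ((Φ β ∘ Dd ν ∘ G0) ∘ Dv) (BdX β·e^{−δ₃d})` whenever `BdX β ≥ (d+1)·((1 + C_Lip)·(BZ β·L₀)·((CJG d ℓ b p (thetaL d ℓ ϑF) (w (sch β)) δ_J)·L₀)·c)`.
* ★★ `pXdDH_graded_of_thm33G0Dir` — the same from the certificate's derived schema `Thm33G0Dir 𝔬 𝔭 Dd Dds R₀ H₀ bHX …` when its exponent-indexed input family reads the
  transported bond classes, `hbHX : ∀ γ ∈ (0,1), bHX γ = bHZKT (taxiB U) γ p` (schedule `ε β := (1−β)∕2`, i.e. the member at `β + (1−β)∕2 ∈ (β,1)` — print's `β + ε`);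
  ★ `thm33G0DirX_graded_of_thm33G0Dir` — with the zeroth-order probe `hpX0`, the whole face `Thm33G0DirX 𝔬 𝔭 Dd R₀ H₀ _ (weightNorm (bHZG (taxiS U) p w) len⁻¹) Bx0 BdX δ₀′ δ₃ U`.
MODEL ∕ DECLARED READINGS.  As dag-n06-w6's smooth file (their (M1)–(M4)), with: source class graded-transported (sites), input class transported at exponent `sch β` (bonds),
letter constant `CJG` (radius discharged by LAYER B inside `hasMaj_JcoKH_graded`).  DISPLAYED: `hU`, `hF`, `h45`, the schedule and weight data, the geometry facts.
HONEST SCOPE.  Bookkeeping (one application of dag-n06-w6's engine per direction and exponent); NOT a node discharge, NOT summit progress; count-neutral; nothing continuum ∕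
OS ∕ mass gap ∕ Clay.  Cell `pub-ymgap` (HUMAN RULING D-0062), Track A node N06 [B9], seat `pub-ymgap-dag-n06-l` (bundle F7 rows 20–21; gen 21), 2026-08-28.  NEW file
importing dag-n06-w6's `B9Thm33G0DirXHolderFromDds` and this seat's `B9Thm313WholeDvHolderAtPinsGraded`; nothing landed is modified.  Net new unproved facts: 0.
-/

noncomputable section

namespace Literature.MathematicalPhysics.QuantumFieldTheory.Balaban1983to89.B9Thm33G0DirXHolderAtPinsGraded

open scoped Matrix.Norms.L2Operator
open Node00 B6KLevelCensusIndexV1 B9BackgroundsKLevelV1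
open B11SectG (HasMaj BlockNorm RowSum)
open B9SectDSup (weightNorm)
open B9Thm34Ext (toB6)
open B9Thm312Whole (GeoOK Ops)
open B9Thm312WholeDir (Thm33G0Dir)
open B9Thm312WholeStepDirFrom3131 (Thm33G0DirX)
open B9RWSums343Holder (HolderProbes)
open B9Thm312WholeClasses (cNormR)
open B9RWSums343to347Whole (Facts347)
open B9GeoNormsKLevelV1 (geo9K)
open B9CoReadingCoords (XBK coordOpK cdsBₗ)
open B9CoReadingCoordsS (XSK)
open Node00.OpsYSectDCoords (DvcoKH)
open B9GradViaDivLettersAtPins (JcoKH DvcoKH_eq_sum)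
open B9Thm33G0DirXHolderFromDds (pXdDH_of_h45m_noLen)
open B9MultiscaleSmoothPartitionYLip (CLip CLip_nonneg)
open B9SmoothHolderClassT (bHZKT bHZKT_κ)
open B9SmoothHolderClassGraded (bHZG)
open B9GradViaDivLettersTransported (taxiS taxiB)
open B9Thm313WholeDvHolderAtPinsGraded (thetaL thetaL_nonneg CJG CJG_nonneg hasMaj_JcoKH_graded)
open B9TaxiTransportLadder (plaqV)
open Node00.OpsYNablaBridge (chartY)
open B6GlobalChartV1 (PV blkV1)
open B6Ineq2142KLevelV1 (β)
open B6Geom246MultiLevelTorus (geomT)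

variable {𝔸 : Type} [NormedRing 𝔸] [NormedAlgebra ℂ 𝔸] [CompleteSpace 𝔸] [FiniteDimensional ℝ 𝔸]
variable {d ℓ : ℕ} {hd : 1 ≤ d + 1} {hL : Odd (ℓ + 1) ∧ 1 < ℓ + 1} {b₀ b₁ : ℝ}
variable (i : KIdx d ℓ hd hL b₀ b₁) [Fintype (geo9K i).Site]
variable {κ : Type} [Fintype κ] (b : Module.Basis κ ℝ 𝔸) (B : B9.Backgrounds) (cfg : B.Cfg → CfgY 𝔸 i)

/-- ★★ **THE W-c FACE Φ^X_β∘∇_{U,ν}∘G₀∘D_U AT THE GRADED TRANSPORTED PIN, FROM ONE (3.45) SCHEMA READ ALONG AN EXPONENT SCHEDULE** (module docstring): for every `ν`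
and every `β ∈ [0,1)`, `HasMaj (weightNorm (bHZG i b (taxiS U₁) p w) (Lʲη)⁻¹) (𝔠_P^{(β−1)}) ((Φ β ∘ Dd ν ∘ G0) ∘ Dv) (BdX β·e^{−δ₃d})` — dag-n06-w6's engine
`pXdDH_of_h45m_noLen` with the kinematic decomposition `Dv = Σ_μ Dds μ ∘ J_μ(U₁)` (`hDv`, `hDds`), the transported J-letter `hasMaj_JcoKH_graded` at the exponent `sch β`
(binders `hU`, `hF`; NO `hΘ`), and the (3.45) member `h45 ν μ β` at the transported bond class `bHZKT i b (taxiB U₁) (sch β) p`; constants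
`BdX β ≥ (d+1)·((1 + C_Lip d ℓ)·(BZ β·L₀)·((CJG d ℓ b p (thetaL d ℓ ϑF) (w (sch β)) δ_J)·L₀)·c)`, rates `0 ≤ δ₃ ≤ δ₀ − αδ_F`, `δ₃ + σ ≤ δ_J − αδ_F`.
[cite: Balaban1985BackgroundPropagators, Thm 3.3 (3.45) p.398 + (3.43) p.398 + (3.40) p.397 + (3.35) p.396 + (3.3) p.390 + p.398 (remark after (3.47)) + pp.421–423; Balaban1984PropagatorsII, (2.51)–(2.56) pp.232–233 + Lemma 2.1 (2.60)–(2.61) p.234] -/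
theorem pXdDH_graded_of_h45 {bI : FBondY i → IBondY i}
    (hβ1 : ∀ f : FBondY i, (geomT i.D).dist (β i.hN i.D i.hk (bI f)) (blkV1 i.hN i.D f) ≤ 1)
    (hbI0 : ∀ f : FBondY i, bI f = bI ⟨f.src, 0⟩) {U₁ : B.Cfg}
    (hU : ∀ (ν : Fin (d + 1)) (s : Site (PV d ℓ i.m i.K hd hL) 0), ‖(cfg U₁ ν s : 𝔸)‖ ≤ 1 ∧ ‖(((cfg U₁ ν s)⁻¹ : 𝔸ˣ) : 𝔸)‖ ≤ 1)
    {ϑF : ℝ} (hϑF : 0 ≤ ϑF)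
    (hF : ∀ (y : Site (PV d ℓ i.m i.K hd hL) 0) (μ' ν' : Fin (d + 1)),
      ‖(plaqV (cfg U₁) y μ' ν' : 𝔸) - 1‖ ≤ ϑF * ((((ℓ + 1 : ℕ) : ℝ)) ^ levY i (chartY i y))⁻¹)
    {p : ℝ} (h1p : 1 ≤ p) (w : ℝ → ℝ) (hw0 : ∀ s, 0 ≤ w s) (hw1 : ∀ s, w s ≤ 1)
    (sch : ℝ → ℝ) (hsch0 : ∀ β', 0 ≤ β' → β' < 1 → 0 < sch β') (hsch1 : ∀ β', 0 ≤ β' → β' < 1 → sch β' < 1)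
    (hwsch : ∀ β', 0 ≤ β' → β' < 1 → 0 < w (sch β'))
    {R₀ : ℝ} {H₀ : Prop} (hG : GeoOK (geo9K i)) {σ c : ℝ} (hrow : RowSum (toB6 (geo9K i) R₀ H₀) σ c)
    {dF : ℕ} {δF α L₀ : ℝ} (hFa : Facts347 (geo9K i) R₀ H₀ dF δF α L₀) {PX : Type} [Fintype PX] {blkPX : PX → (geo9K i).Site}
    {Φ : ℝ → ((XBK κ i → ℝ) →ₗ[ℝ] (PX → ℝ))} {G0 : Module.End ℝ (XBK κ i → ℝ)} {Dd Dds : Fin (d + 1) → Module.End ℝ (XBK κ i → ℝ)}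
    {Dv : (XSK κ i → ℝ) →ₗ[ℝ] (XBK κ i → ℝ)}
    (hDv : Dv = DvcoKH i b B cfg U₁) (hDds : Dds = fun μ => coordOpK b (fun _ : Fin (d + 1) => cdsBₗ i (cfg U₁) μ))
    {BZ : ℝ → ℝ} {δ₀ δJ δ₃ : ℝ} {BdX : ℝ → ℝ}
    (hBZ : ∀ β', 0 ≤ β' → β' < 1 → 0 ≤ BZ β') (hc : 0 ≤ c) (hδJ : 0 ≤ δJ)
    (hδ₃ : 0 ≤ δ₃) (hδ₃0 : δ₃ ≤ δ₀ - α * δF) (hδ₃J : δ₃ + σ ≤ δJ - α * δF)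
    (hBdX : ∀ β', 0 ≤ β' → β' < 1 →
      ((d : ℝ) + 1) * ((1 + CLip d ℓ) * (BZ β' * L₀) * ((CJG d ℓ b p (thetaL d ℓ ϑF) (w (sch β')) δJ) * L₀) * c) ≤ BdX β')
    (h45 : ∀ (ν μ : Fin (d + 1)) (β' : ℝ) (h0 : 0 ≤ β') (h1 : β' < 1),
      HasMaj (bHZKT (κ := κ) i b (taxiB i B cfg U₁) (R := R₀) (H := H₀) (hsch0 β' h0 h1).le (hsch1 β' h0 h1).le ((hsch1 β' h0 h1).le.trans h1p))
        (BlockNorm.ofBlocks (toB6 (geo9K i) R₀ H₀) blkPX)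
        (Φ β' ∘ₗ (Dd ν ∘ₗ (G0 ∘ₗ Dds μ))) (fun a a' => BZ β' * (geo9K i).len a ^ (-β') * Real.exp (-(δ₀ * (geo9K i).dist a a')))) :
    ∀ (ν : Fin (d + 1)) (β' : ℝ), 0 ≤ β' → β' < 1 →
      HasMaj (weightNorm (bHZG (κ := κ) i b (taxiS i B cfg U₁) (R := R₀) (H := H₀) h1p w hw0 hw1) (fun y => ((geo9K i).len y)⁻¹)
          (fun y => inv_nonneg.mpr (hG.lenle y)))
        (cNormR R₀ H₀ blkPX hG.lenle (β' - 1)) ((Φ β' ∘ₗ Dd ν ∘ₗ G0) ∘ₗ Dv)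
        (fun a a' => BdX β' * Real.exp (-(δ₃ * (geo9K i).dist a a'))) := by
  intro ν β' hβ0 hβ1'
  have hCJ : 0 ≤ CJG d ℓ b p (thetaL d ℓ ϑF) (w (sch β')) δJ := CJG_nonneg (d := d) (ℓ := ℓ) b (thetaL_nonneg d ℓ hϑF) (hwsch β' hβ0 hβ1') δJ
  -- the kinematic decomposition at the pins: `Dv = Σ_μ Dds μ ∘ₗ J_μ(U₁)`
  have hDv' : Dv = ∑ μ, Dds μ ∘ₗ JcoKH i b B cfg μ U₁ := by
    rw [hDv, hDds]
    exact DvcoKH_eq_sum i b B cfg U₁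
  have hBdX' : (Fintype.card (Fin (d + 1)) : ℝ) *
      ((1 + CLip d ℓ) * (BZ β' * L₀) * ((CJG d ℓ b p (thetaL d ℓ ϑF) (w (sch β')) δJ) * L₀) * c) ≤ BdX β' := by
    rw [Fintype.card_fin, Nat.cast_add, Nat.cast_one]
    exact hBdX β' hβ0 hβ1'
  have hκ : (bHZKT (κ := κ) i b (taxiB i B cfg U₁) (R := R₀) (H := H₀) (hsch0 β' hβ0 hβ1').le (hsch1 β' hβ0 hβ1').le
      ((hsch1 β' hβ0 hβ1').le.trans h1p)).κ ≤ 1 + CLip d ℓ := le_of_eq (bHZKT_κ i b _ _ _ _)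
  exact pXdDH_of_h45m_noLen hG hrow hFa (hBZ β' hβ0 hβ1') hCJ hc hκ hδ₃ hδ₃0 hδ₃J hBdX' hDv'
    (fun μ => h45 ν μ β' hβ0 hβ1')
    (fun μ => hasMaj_JcoKH_graded i b B cfg h1p w hw0 hw1 (hsch0 β' hβ0 hβ1') (hsch1 β' hβ0 hβ1') (hwsch β' hβ0 hβ1') hβ1 hbI0 hU hϑF hF hδJ μ)

/-! ## §2 ★★ From the certificate's derived `Thm33G0Dir` when its input family reads the transported bond classes; the whole face -/

/-- ★★ **`Thm33G0DirX.pXdDH` AT THE GRADED TRANSPORTED PIN FROM THE DERIVED `Thm33G0Dir`** — if `Thm33G0Dir 𝔬 𝔭 Dd Dds R₀ H₀ bHX …` (`h33`; its (3.45) members `h45m q ε β`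
at `bHX (β + ε)`) reads its exponent-indexed input family on `(0,1)` as the transported bond classes (`hbHX : bHX γ = bHZKT i b (taxiB U₁) γ p`, `1 ≤ p`) and `𝔬.Dv U₁`,
`Dds U₁` are the kinematic models (`hDv`, `hDds`), then under `hU`, `hF`, weights `w` positive along the schedule `β ↦ β + (1−β)∕2` and the geometry facts, for every `ν`
and `β ∈ [0,1)`: `HasMaj (weightNorm (bHZG i b (taxiS U₁) p w) (len)⁻¹) (cNormR R₀ H₀ 𝔭.blkPX _ (β − 1)) ((𝔭.ΦX U₁ β ∘ₗ Dd U₁ ν ∘ₗ 𝔬.G0 U₁) ∘ₗ 𝔬.Dv U₁) (BdX β·e^{−δ₃d})`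
with `BdX β ≥ (d+1)·((1 + C_Lip d ℓ)·(Bi2 ((1−β)∕2) β·L₀)·((CJG d ℓ b p (thetaL d ℓ ϑF) (w (β + (1−β)∕2)) δ_J)·L₀)·c)` — print's `‖λ‖_{β+ε}` input at `ε = (1−β)∕2`.
[cite: Balaban1985BackgroundPropagators, Thm 3.3 (3.45) p.398 + (3.43) p.398 + (3.40) p.397 + (3.35) p.396 + (3.3) p.390 + pp.421–423; Balaban1984PropagatorsII, (2.51)–(2.56) pp.232–233 + Lemma 2.1 (2.60)–(2.61) p.234] -/
theorem pXdDH_graded_of_thm33G0Dir {bI : FBondY i → IBondY i}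
    (hβ1 : ∀ f : FBondY i, (geomT i.D).dist (β i.hN i.D i.hk (bI f)) (blkV1 i.hN i.D f) ≤ 1)
    (hbI0 : ∀ f : FBondY i, bI f = bI ⟨f.src, 0⟩) {U₁ : B.Cfg}
    (hU : ∀ (ν : Fin (d + 1)) (s : Site (PV d ℓ i.m i.K hd hL) 0), ‖(cfg U₁ ν s : 𝔸)‖ ≤ 1 ∧ ‖(((cfg U₁ ν s)⁻¹ : 𝔸ˣ) : 𝔸)‖ ≤ 1)
    {ϑF : ℝ} (hϑF : 0 ≤ ϑF)
    (hF : ∀ (y : Site (PV d ℓ i.m i.K hd hL) 0) (μ' ν' : Fin (d + 1)),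
      ‖(plaqV (cfg U₁) y μ' ν' : 𝔸) - 1‖ ≤ ϑF * ((((ℓ + 1 : ℕ) : ℝ)) ^ levY i (chartY i y))⁻¹)
    {p : ℝ} (h1p : 1 ≤ p) (w : ℝ → ℝ) (hw0 : ∀ s, 0 ≤ w s) (hw1 : ∀ s, w s ≤ 1)
    (hwsch : ∀ β', 0 ≤ β' → β' < 1 → 0 < w (β' + (1 - β') / 2))
    {R₀ : ℝ} {H₀ : Prop} (hG : GeoOK (geo9K i)) {σ c : ℝ} (hrow : RowSum (toB6 (geo9K i) R₀ H₀) σ c)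
    {dF : ℕ} {δF α L₀ : ℝ} (hFa : Facts347 (geo9K i) R₀ H₀ dF δF α L₀) {Z PX PY : Type} [Fintype PX] [Fintype PY]
    {𝔬 : Ops (geo9K i) B (XBK κ i) (XBK κ i) Z (XSK κ i)} {𝔭 : HolderProbes (geo9K i) B (XBK κ i) (XBK κ i) PX PY}
    {Dd Dds : B.Cfg → Fin (d + 1) → Module.End ℝ (XBK κ i → ℝ)}
    {bHX : ℝ → BlockNorm (toB6 (geo9K i) R₀ H₀) (XBK κ i → ℝ)} {B₀ δ₀ : ℝ} {Bh Bi : ℝ → ℝ} {Bi2 : ℝ → ℝ → ℝ}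
    (h33 : Thm33G0Dir 𝔬 𝔭 Dd Dds R₀ H₀ bHX B₀ Bh Bi Bi2 δ₀ U₁)
    (hbHX : ∀ (γ : ℝ) (h0 : 0 < γ) (h1 : γ < 1),
      bHX γ = bHZKT (κ := κ) i b (taxiB i B cfg U₁) (R := R₀) (H := H₀) h0.le h1.le (h1.le.trans h1p))
    (hDv : 𝔬.Dv U₁ = DvcoKH i b B cfg U₁)
    (hDds : Dds U₁ = fun μ => coordOpK b (fun _ : Fin (d + 1) => cdsBₗ i (cfg U₁) μ))
    {δJ δ₃ : ℝ} {BdX : ℝ → ℝ}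
    (hBi2 : ∀ e b', 0 < e → e ≤ 1 → 0 ≤ b' → b' < 1 → 0 ≤ Bi2 e b') (hc : 0 ≤ c) (hδJ : 0 ≤ δJ)
    (hδ₃ : 0 ≤ δ₃) (hδ₃0 : δ₃ ≤ δ₀ - α * δF) (hδ₃J : δ₃ + σ ≤ δJ - α * δF)
    (hBdX : ∀ β', 0 ≤ β' → β' < 1 →
      ((d : ℝ) + 1) * ((1 + CLip d ℓ) * (Bi2 ((1 - β') / 2) β' * L₀) *
        ((CJG d ℓ b p (thetaL d ℓ ϑF) (w (β' + (1 - β') / 2)) δJ) * L₀) * c) ≤ BdX β') :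
    ∀ (ν : Fin (d + 1)) (β' : ℝ), 0 ≤ β' → β' < 1 →
      HasMaj (weightNorm (bHZG (κ := κ) i b (taxiS i B cfg U₁) (R := R₀) (H := H₀) h1p w hw0 hw1) (fun y => ((geo9K i).len y)⁻¹)
          (fun y => inv_nonneg.mpr (hG.lenle y)))
        (cNormR R₀ H₀ 𝔭.blkPX hG.lenle (β' - 1)) ((𝔭.ΦX U₁ β' ∘ₗ Dd U₁ ν ∘ₗ 𝔬.G0 U₁) ∘ₗ 𝔬.Dv U₁)
        (fun a a' => BdX β' * Real.exp (-(δ₃ * (geo9K i).dist a a'))) := by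
  have hsch0 : ∀ β' : ℝ, 0 ≤ β' → β' < 1 → 0 < β' + (1 - β') / 2 := fun β' h0 h1 => by linarith
  have hsch1 : ∀ β' : ℝ, 0 ≤ β' → β' < 1 → β' + (1 - β') / 2 < 1 := fun β' h0 h1 => by linarith
  refine pXdDH_graded_of_h45 i b B cfg hβ1 hbI0 hU hϑF hF h1p w hw0 hw1 (fun β' => β' + (1 - β') / 2) hsch0 hsch1 hwsch hG hrow hFa
    (Φ := 𝔭.ΦX U₁) (G0 := 𝔬.G0 U₁) (Dd := Dd U₁) (Dds := Dds U₁) hDv hDds (BZ := fun β' => Bi2 ((1 - β') / 2) β')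
    (fun β' h0 h1 => hBi2 ((1 - β') / 2) β' (by linarith) (by linarith) h0 h1) hc hδJ hδ₃ hδ₃0 hδ₃J hBdX ?_
  intro ν μ β' hβ0 hβ1'
  have h := h33.h45m (ν, μ) ((1 - β') / 2) β' (by linarith) (by linarith) hβ0 hβ1'
  rw [hbHX (β' + (1 - β') / 2) (hsch0 β' hβ0 hβ1') (hsch1 β' hβ0 hβ1')] at h
  exact h

/-- ★ **THE WHOLE W-c FACE `Thm33G0DirX` AT THE GRADED TRANSPORTED PIN**: `pXdDH_graded_of_thm33G0Dir` + the zeroth-order probe `hpX0` in its own shape give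
`Thm33G0DirX 𝔬 𝔭 Dd R₀ H₀ _ (weightNorm (bHZG i b (taxiS U₁) p w) (len)⁻¹) Bx0 BdX δ₀′ δ₃ U₁`.
[cite: Balaban1985BackgroundPropagators, Thm 3.3 p.399 + (3.42)–(3.45) pp.397–398 + (3.35) p.396 + (3.3) p.390 + pp.421–423; Balaban1984PropagatorsII, (2.51)–(2.56) pp.232–233 + Lemma 2.1 (2.60)–(2.61) p.234] -/
theorem thm33G0DirX_graded_of_thm33G0Dir {bI : FBondY i → IBondY i}
    (hβ1 : ∀ f : FBondY i, (geomT i.D).dist (β i.hN i.D i.hk (bI f)) (blkV1 i.hN i.D f) ≤ 1)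
    (hbI0 : ∀ f : FBondY i, bI f = bI ⟨f.src, 0⟩) {U₁ : B.Cfg}
    (hU : ∀ (ν : Fin (d + 1)) (s : Site (PV d ℓ i.m i.K hd hL) 0), ‖(cfg U₁ ν s : 𝔸)‖ ≤ 1 ∧ ‖(((cfg U₁ ν s)⁻¹ : 𝔸ˣ) : 𝔸)‖ ≤ 1)
    {ϑF : ℝ} (hϑF : 0 ≤ ϑF)
    (hF : ∀ (y : Site (PV d ℓ i.m i.K hd hL) 0) (μ' ν' : Fin (d + 1)),
      ‖(plaqV (cfg U₁) y μ' ν' : 𝔸) - 1‖ ≤ ϑF * ((((ℓ + 1 : ℕ) : ℝ)) ^ levY i (chartY i y))⁻¹)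
    {p : ℝ} (h1p : 1 ≤ p) (w : ℝ → ℝ) (hw0 : ∀ s, 0 ≤ w s) (hw1 : ∀ s, w s ≤ 1)
    (hwsch : ∀ β', 0 ≤ β' → β' < 1 → 0 < w (β' + (1 - β') / 2))
    {R₀ : ℝ} {H₀ : Prop} (hG : GeoOK (geo9K i)) {σ c : ℝ} (hrow : RowSum (toB6 (geo9K i) R₀ H₀) σ c)
    {dF : ℕ} {δF α L₀ : ℝ} (hFa : Facts347 (geo9K i) R₀ H₀ dF δF α L₀) {Z PX PY : Type} [Fintype PX] [Fintype PY]
    {𝔬 : Ops (geo9K i) B (XBK κ i) (XBK κ i) Z (XSK κ i)} {𝔭 : HolderProbes (geo9K i) B (XBK κ i) (XBK κ i) PX PY}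
    {Dd Dds : B.Cfg → Fin (d + 1) → Module.End ℝ (XBK κ i → ℝ)}
    {bHX : ℝ → BlockNorm (toB6 (geo9K i) R₀ H₀) (XBK κ i → ℝ)} {B₀ δ₀ : ℝ} {Bh Bi : ℝ → ℝ} {Bi2 : ℝ → ℝ → ℝ}
    (h33 : Thm33G0Dir 𝔬 𝔭 Dd Dds R₀ H₀ bHX B₀ Bh Bi Bi2 δ₀ U₁)
    (hbHX : ∀ (γ : ℝ) (h0 : 0 < γ) (h1 : γ < 1),
      bHX γ = bHZKT (κ := κ) i b (taxiB i B cfg U₁) (R := R₀) (H := H₀) h0.le h1.le (h1.le.trans h1p))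
    (hDv : 𝔬.Dv U₁ = DvcoKH i b B cfg U₁)
    (hDds : Dds U₁ = fun μ => coordOpK b (fun _ : Fin (d + 1) => cdsBₗ i (cfg U₁) μ))
    {δJ δ₃ δ₀' : ℝ} {Bx0 BdX : ℝ → ℝ}
    (hBi2 : ∀ e b', 0 < e → e ≤ 1 → 0 ≤ b' → b' < 1 → 0 ≤ Bi2 e b') (hc : 0 ≤ c) (hδJ : 0 ≤ δJ)
    (hδ₃ : 0 ≤ δ₃) (hδ₃0 : δ₃ ≤ δ₀ - α * δF) (hδ₃J : δ₃ + σ ≤ δJ - α * δF)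
    (hBdX : ∀ β', 0 ≤ β' → β' < 1 →
      ((d : ℝ) + 1) * ((1 + CLip d ℓ) * (Bi2 ((1 - β') / 2) β' * L₀) *
        ((CJG d ℓ b p (thetaL d ℓ ϑF) (w (β' + (1 - β') / 2)) δJ) * L₀) * c) ≤ BdX β')
    (hpX0 : ∀ β' : ℝ, 0 ≤ β' → β' < 1 → HasMaj (cNormR R₀ H₀ 𝔬.blk hG.lenle 0) (cNormR R₀ H₀ 𝔭.blkPX hG.lenle (β' - 2))
      (𝔭.ΦX U₁ β' ∘ₗ 𝔬.G0 U₁) (fun a a' => Bx0 β' * Real.exp (-(δ₀' * (geo9K i).dist a a')))) :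
    Thm33G0DirX 𝔬 𝔭 Dd R₀ H₀ hG.lenle
      (weightNorm (bHZG (κ := κ) i b (taxiS i B cfg U₁) (R := R₀) (H := H₀) h1p w hw0 hw1) (fun y => ((geo9K i).len y)⁻¹)
        (fun y => inv_nonneg.mpr (hG.lenle y)))
      Bx0 BdX δ₀' δ₃ U₁ :=
  ⟨hpX0, pXdDH_graded_of_thm33G0Dir i b B cfg hβ1 hbI0 hU hϑF hF h1p w hw0 hw1 hwsch hG hrow hFa h33 hbHX hDv hDds hBi2 hc hδJ hδ₃ hδ₃0 hδ₃J hBdX⟩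

end Literature.MathematicalPhysics.QuantumFieldTheory.Balaban1983to89.B9Thm33G0DirXHolderAtPinsGraded
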